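import Summits.RiemannHypothesis.RiemannHypothesis.Theorems.TiltedLandingLaw421R3PerturbativeRung
import Summits.RiemannHypothesis.RiemannHypothesis.Theorems.TiltedLandingLaw421R3RateIsolationSign
import Summits.RiemannHypothesis.RiemannHypothesis.Theorems.TiltedLandingLaw421R3NewtonDoorLocated
import Summits.RiemannHypothesis.RiemannHypothesis.Theorems.TiltedLandingLaw421R3RateUncoveredR1uSplit

/-!
# RATE helper — K-3b, the LIGHT ISOLATED CHILD (R1uᵀ existence half, LIGHT ∧ `λ > 9(1+M)` sub-case): `LowChildAt f j v`

TOUCH class, rung R1uᵀ of ⟨33346⟩ `TiltedLandingLaw421R`, route EarlyAppointments (lens-2 l.8145 (2) — binders VERBATIM; director (CA648)(B)(2) /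
(CA652) / (CA655); W-08 C4 desk rh-idea-6 g39).  One namespace `RhW08.LightIsolatedChild`, four imports: token 28 `…R3PerturbativeRung`
(`RhW08.PerturbativeRung.fieldK / fieldK_dslope / LightWitness / rhoMu / doorData_of_lightWitness`, image `lens2/RungP-v5.lean` c66cad57b70f40b9),
token 29 `…R3RateIsolationSign` (`RhW08.IsolationSign.im_newtonK_le_of_lateral_isolation`, image 68 b7f6b540f0a00bcc), and the TREE modules
`…R3NewtonDoorLocated` (#1177, `RhW08.NewtonDoor.located_newton_door_lip`, `…factor_dslope`, `…norm_sub_le_of_newtonDisc`) and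
`…R3RateUncoveredR1uSplit` (#1175, `RhW08.UncoveredSplit.LowChildAt / lowChildAt_of_disc`).  This file elaborates as soon as 28 and 29 are tree
(byte-identical to their images); until then its checked form is the CHAIN `K3bLightIsolatedChild-CHAIN-W08-C4-rh-idea-6-g39.lean` (tree imports ∪,
RungP-v5 l.2–227 ⊕ image 68 l.5–332 ⊕ this body, verbatim).

★★★ `lowChildAt_of_light_isolated`: `EngineHyps5 2 η f x₀ s hmax R Hs B → f⁽ʲ⁾ v = 0 → 0 < Im v → 0 ≤ M → LightWitness (dslope f⁽ʲ⁾ v) v M →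
(9/2)(1+M) ≤ (Im v·‖K_v‖)²/2 → 9(1+M) < Im v·‖K_v‖ → (∀ z, f⁽ʲ⁾ z = 0 → |Re z − Re v| < R/2 → z = v ∨ z = v̄) → LowChildAt f j v`
(`K_v = RhW08.AntiEscapeSplit7.newtonK f j v = fieldK (dslope f⁽ʲ⁾ v) v`, `rfl`).
STEPS (lens-2's (a)(b)(c) by name): (a) DOOR — the light witness at `u = v` gives `dslope f⁽ʲ⁾ v v = f⁽ʲ⁺¹⁾(v) ≠ 0` (simplicity) and, with `C₀ = 9/2`,
`doorData_of_lightWitness` ⇒ `0 < ρ₀ ≤ 1/2`, the scalar door condition, the cofactor zero-free on the closed Newton disc and `Λ`-close on the Newton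
circle ⇒ `located_newton_door_lip` (factorisation `factor_dslope`): a zero `w` of `f⁽ʲ⁺¹⁾` (`iteratedDeriv_succ`) with `‖w − (v − K⁻¹)‖ < ρ₀/‖K‖` and
cofactor `≠ 0` at `w`, hence `w ≠ v` and `f⁽ʲ⁾ w ≠ 0`; (b) BELOW — `‖w − v‖ ≤ (1+ρ₀)/‖K‖ ≤ (3/2)/‖K‖ ≤ Im v/6` (`λ > 9`) so `0 < Im w`, and
`Im w ≤ Im v + Im K/‖K‖² + ρ₀/‖K‖ < Im v` (`im_newtonPoint`, `im_lt_of_located`) because K-3 gives `Im K ≤ −1/(2 Im v)` and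
`ρ₀·λ² = (9/2)(1+M)` with `9(1+M) < λ` gives `2λρ₀ < 1`; (c) DISC — `Literature.Analysis.Complex.jensen_circle` (class data
`RhW08.Column.realEntireLt2_of_hyps` + `RhW08.WindowLoss.realEntireLt2_iteratedDeriv`, `∃ z, F′ z ≠ 0` at `z = v`) puts `w` in the closed Jensen disc of a
zero `a` of `f⁽ʲ⁾`; `a` is non-real (`0 < Im w`) and its upper representative `z` (Schwarz reflection `Literature.Analysis.Complex.apply_conj_eq_conj`) is
either within lateral `R/2` of `v` — then `z = v` by isolation (`z = v̄` has `Im < 0`) and `lowChildAt_of_disc` — or FAR, and a far disc that reaches `w`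
is TALL: `im_le_of_far_disc` (plane geometry: `Im v, Im z ≤ Hs ≤ R/2` by `RhW08.Column.abs_im_le_of_level` and `2·Hs ≤ R`, `|Re z − Re v| ≥ R/2`,
`‖w − v‖ ≤ Im v/6` ⇒ `Im v ≤ Im z`), and it meets `v`'s disc (`|Re z − Re v| ≤ Im z + Im v/6`) — the second witness shape of `LowChildAt`.
(lens-2's (c) names `RhW08.ClusterCount.child_mem_disc`; that lemma wants Jensen-CLEAR abscissae `α < Re w < β`, which a general frame does not supply
near `v` — its engine `jensen_circle` is used directly instead, with the same conclusion.)
SCOPE OF RECORD ((CA652)/(CA655), lens-2 HONEST GAP): K-3 ∘ K-3b settle ONLY the LIGHT ∧ `λ_N > 9(1+M)` sub-case of `RhW08.UncoveredSplit.TouchedLowChildLawJ`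
(which carries neither lightness nor a λ-floor at `v`); the heavy / low-field remainder of R1uᵀ is law-shaped and OPEN; no law is typed or weakened
here, no stub / crux is closed.  Nothing here bears on the truth of RH; RH is not proved; R1uᵀ / RUNG-P / ★A / 33346 / 33347 OPEN.
-/

namespace RhW08.LightIsolatedChild

open Complex
open scoped ComplexConjugate
open RhW08.PerturbativeRung (fieldK fieldK_dslope LightWitness rhoMu doorData_of_lightWitness)
open RhW08.AntiEscapeSplit7 (newtonK)
open RhW08.UncoveredSplit (LowChildAt lowChildAt_of_disc)
open Summit.RiemannHypothesis.RiemannHypothesis.Theorems.Splittings.JensenWindow (RealEntireLt2)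

/-- (K) the height of the Newton point: `Im (v − K⁻¹) = Im v + Im K/‖K‖²`. -/
theorem im_newtonPoint (v K : ℂ) : (v - K⁻¹).im = v.im + K.im / ‖K‖ ^ 2 := by
  rw [sub_im, inv_im, Complex.normSq_eq_norm_sq]
  ring

/-- (K) BELOW `v`: if `Im K ≤ −1/(2·Im v)` (the isolation sign K-3), `‖w − (v − K⁻¹)‖ < ρ₀/‖K‖` (the located Newton disc) and
`2·λ·ρ₀ ≤ 1` (`λ = Im v·‖K‖`), then `Im w < Im v`: the disc error `ρ₀/‖K‖` is at most the mate's pull `1/(2·Im v·‖K‖²)`. -/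
theorem im_lt_of_located {v K w : ℂ} {ρ₀ : ℝ} (hv : 0 < v.im) (hK : K ≠ 0) (hsign : K.im ≤ -(1 / (2 * v.im)))
    (hw : ‖w - (v - K⁻¹)‖ < ρ₀ / ‖K‖) (hρ : 2 * (v.im * ‖K‖) * ρ₀ ≤ 1) : w.im < v.im := by
  have hKn : 0 < ‖K‖ := norm_pos_iff.mpr hK
  have h1 : (w - (v - K⁻¹)).im ≤ ‖w - (v - K⁻¹)‖ := le_trans (le_abs_self _) (abs_im_le_norm _)
  rw [sub_im, im_newtonPoint] at h1
  have h3 : K.im / ‖K‖ ^ 2 ≤ -(1 / (2 * v.im)) / ‖K‖ ^ 2 := div_le_div_of_nonneg_right hsign (by positivity)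
  have h4 : ρ₀ / ‖K‖ ≤ (1 / (2 * v.im)) / ‖K‖ ^ 2 := by
    rw [div_le_div_iff₀ hKn (by positivity)]
    have h5 : ρ₀ * ‖K‖ ≤ 1 / (2 * v.im) := by
      rw [le_div_iff₀ (by positivity)]
      nlinarith
    nlinarith [h5, hKn]
  have h6 : -(1 / (2 * v.im)) / ‖K‖ ^ 2 + (1 / (2 * v.im)) / ‖K‖ ^ 2 = 0 := by ring
  linarith

/-- (K) FAR DISCS ARE TALL (plane geometry of the frame): `0 < Im v ≤ R/2`, `Im z ≤ R/2`, `|Re z − Re v| ≥ R/2`, `w` in the closed Jensen disc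
of `z` (`‖w − Re z‖ ≤ Im z`) and `‖w − v‖ ≤ Im v/6` force `Im v ≤ Im z` — a far disc short of `Im v` cannot reach within `Im v/6` of `v`. -/
theorem im_le_of_far_disc {v w z : ℂ} {R : ℝ} (hv : 0 < v.im) (hvR : v.im ≤ R / 2) (hzR : z.im ≤ R / 2)
    (hfar : R / 2 ≤ |z.re - v.re|) (hwz : ‖w - (z.re : ℂ)‖ ≤ z.im) (hwv : ‖w - v‖ ≤ v.im / 6) : v.im ≤ z.im := by
  by_contra hlt
  push Not at hlt
  have hre : |w.re - v.re| ≤ v.im / 6 := le_trans (by simpa using abs_re_le_norm (w - v)) hwv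
  have him : |w.im - v.im| ≤ v.im / 6 := le_trans (by simpa using abs_im_le_norm (w - v)) hwv
  have hz0 : 0 ≤ z.im := le_trans (norm_nonneg _) hwz
  have hsq : (w.re - z.re) ^ 2 + w.im ^ 2 ≤ z.im ^ 2 := by
    have e : ‖w - (z.re : ℂ)‖ ^ 2 = (w.re - z.re) ^ 2 + w.im ^ 2 := by
      rw [← Complex.normSq_eq_norm_sq, Complex.normSq_apply]
      simp
      ring
    rw [← e]
    exact pow_le_pow_left₀ (norm_nonneg _) hwz 2
  have h1 : R / 2 - v.im / 6 ≤ |w.re - z.re| := by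
    rw [abs_sub_comm]
    linarith [abs_sub_le z.re w.re v.re]
  have hpos1 : 0 ≤ R / 2 - v.im / 6 := by linarith
  have hsq1 : (R / 2 - v.im / 6) ^ 2 ≤ (w.re - z.re) ^ 2 := by
    have h := pow_le_pow_left₀ hpos1 h1 2
    rwa [sq_abs] at h
  have h2 : v.im - v.im / 6 ≤ w.im := by linarith [(abs_le.mp him).1]
  have hsq2 : (v.im - v.im / 6) ^ 2 ≤ w.im ^ 2 := pow_le_pow_left₀ (by linarith) h2 2
  have hz2 : z.im ^ 2 < v.im ^ 2 := by nlinarith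
  nlinarith [hsq1, hsq2, hsq, hz2, pow_pos hv 2,
    mul_nonneg (sub_nonneg.mpr (by linarith : 2 * v.im ≤ R)) (by linarith : (0 : ℝ) ≤ R / 4 + v.im / 3)]

open RhIdea6.G17.W07C7 RhIdea6.G17.W07C7.Rev6 RhIdea6.G18.W07C8.Law421BirthS RhIdea6.G19.W07C11.Seam RhIdea6.G20.W07C12.Frac
  RhIdea6.G20.W07C12.StColP RhW07.C12.FieldSplit RhW08.Round1 RhW08.StSwap RhW08.Round2 RhW08.QuadW RhW08.SealSwapQ in
/-- ★★★ **K-3b — THE LIGHT ISOLATED CHILD** (lens-2 l.8145 (2), binders verbatim): on an `EngineHyps5 2` frame, an upper zero `v` of `f⁽ʲ⁾` with a LIGHT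
WITNESS `M` for its cofactor `dslope f⁽ʲ⁾ v` (hence simple), door smallness `(9/2)(1+M) ≤ λ²/2` and `9(1+M) < λ` (`λ = Im v·‖K_v‖`), laterally
`R/2`-isolated, has a LOW CHILD: `LowChildAt f j v`.  Chain (tree names + tokens 28/29): light witness ⇒ door data
`RhW08.PerturbativeRung.doorData_of_lightWitness` (C₀ = 9/2) ⇒ located Newton child `RhW08.NewtonDoor.located_newton_door_lip` (K-1, #1177): a zero `w` of
`f⁽ʲ⁺¹⁾`, not of `f⁽ʲ⁾`, with `‖w − (v − K⁻¹)‖ < ρ₀/‖K‖`; `0 < Im w` and `‖w − v‖ ≤ Im v/6` from `λ > 9`; STRICTLY BELOW `v` by the isolation sign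
`RhW08.IsolationSign.im_newtonK_le_of_lateral_isolation` (K-3, token 29) and `2λρ₀ = 9(1+M)/λ < 1` (`im_lt_of_located`); the Jensen zero `z` above `w`
(`Literature.Analysis.Complex.jensen_circle`, upper representative by Schwarz reflection) is either `v` itself (isolation; then
`RhW08.UncoveredSplit.lowChildAt_of_disc`) or FAR (`|Re z − Re v| ≥ R/2`), and a far disc reaching `w` is TALL (`im_le_of_far_disc`, strip
`RhW08.Column.abs_im_le_of_level` + `2·Hs ≤ R`) and meets `v`'s disc — the second witness shape of `LowChildAt`. -/
theorem lowChildAt_of_light_isolated {η : ℝ} {f : ℂ → ℂ} {x₀ s hmax R Hs : ℝ} {B : ℕ} (hE : EngineHyps5 2 η f x₀ s hmax R Hs B)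
    {j : ℕ} {v : ℂ} (hFv : iteratedDeriv j f v = 0) (hv : 0 < v.im) {M : ℝ} (hM : 0 ≤ M)
    (hW : LightWitness (dslope (iteratedDeriv j f) v) v M)
    (hdoor : (9 / 2) * (1 + M) ≤ (v.im * ‖newtonK f j v‖) ^ 2 / 2) (hbelow : 9 * (1 + M) < v.im * ‖newtonK f j v‖)
    (hiso : ∀ z : ℂ, iteratedDeriv j f z = 0 → |z.re - v.re| < R / 2 → z = v ∨ z = conj v) :
    LowChildAt f j v := by
  rw [← fieldK_dslope f j v] at hdoor hbelow
  set F : ℂ → ℂ := iteratedDeriv j f with hFdef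
  set h : ℂ → ℂ := dslope F v with hhdef
  -- class data of `F` and of its cofactor `h`
  have hG : RealEntireLt2 F := RhW08.WindowLoss.realEntireLt2_iteratedDeriv (RhW08.Column.realEntireLt2_of_hyps hE) j
  have hFdiff : Differentiable ℂ F := hG.diff
  have hh : Differentiable ℂ h := Literature.NumberTheory.LFunctions.BurnolVectors.differentiable_dslope hFdiff v
  have hfac : ∀ u : ℂ, F u = (u - v) * h u := fun u => RhW08.NewtonDoor.factor_dslope hFv u
  -- the light witness at `u = v`: `h v ≠ 0`, i.e. `v` is a simple zero of `F`
  have hKn : 0 < ‖fieldK h v‖ := norm_pos_iff.mpr hW.1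
  have hhv : h v ≠ 0 := (hW.2.2 v (by rw [sub_self, norm_zero]; positivity)).1
  have hsimple : deriv F v ≠ 0 := by
    rw [← dslope_same]
    exact hhv
  have hnz : F ≠ 0 := by
    intro h0
    apply hsimple
    rw [h0]
    simp
  -- door data at `C₀ = 9/2` and the located Newton child `w`
  obtain ⟨hρ0, hρhalf, hscalar, hh0, hlip⟩ := doorData_of_lightWitness hh hv hW (le_refl (9 / 2 : ℝ)) hdoor
  obtain ⟨w, hwdisc, hFw, hhw⟩ :=
    RhW08.NewtonDoor.located_newton_door_lip F h v _ _ _ hFdiff hh hfac hW.1 hρ0 hscalar hh0 hlip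
  set K : ℂ := fieldK h v with hKdef
  set ρ₀ : ℝ := rhoMu (9 / 2) M h v with hρdef
  have hK : K ≠ 0 := hW.1
  have hlam : 0 < v.im * ‖K‖ := mul_pos hv hKn
  have hlam9 : 9 < v.im * ‖K‖ := by nlinarith
  -- `w` is a zero of `f⁽ʲ⁺¹⁾` and not of `f⁽ʲ⁾`
  have hw0 : iteratedDeriv (j + 1) f w = 0 := by
    rw [iteratedDeriv_succ]
    exact hFw
  have hwv_ne : w ≠ v := fun e => hsimple (e ▸ hFw)
  have hGw : F w ≠ 0 := by
    rw [hfac w]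
    exact mul_ne_zero (sub_ne_zero.mpr hwv_ne) hhw
  -- `w` is within `Im v/6` of `v` (so above the axis): `‖w − v‖ ≤ (1+ρ₀)/‖K‖ ≤ (3/2)/‖K‖ ≤ Im v/6` as `λ > 9`
  have hwv : ‖w - v‖ ≤ v.im / 6 := by
    have h1 : ‖w - v‖ ≤ (1 + ρ₀) / ‖K‖ := RhW08.NewtonDoor.norm_sub_le_of_newtonDisc hK hwdisc.le
    have h2 : (1 + ρ₀) / ‖K‖ ≤ v.im / 6 := by
      rw [div_le_div_iff₀ hKn (by norm_num)]
      nlinarith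
    exact h1.trans h2
  have hwim : 0 < w.im := by
    have h3 := abs_im_le_norm (w - v)
    rw [sub_im] at h3
    linarith [(abs_le.mp (h3.trans hwv)).1]
  -- STRICTLY BELOW `v`: the isolation sign (K-3) and `2λρ₀ = 9(1+M)/λ < 1`
  have hsign : K.im ≤ -(1 / (2 * v.im)) := RhW08.IsolationSign.im_newtonK_le_of_lateral_isolation hE hFv hsimple hv hiso
  have hρeq : ρ₀ * (v.im * ‖K‖) ^ 2 = 9 / 2 * (1 + M) := by
    show 9 / 2 * (1 + M) / (v.im * ‖K‖) ^ 2 * (v.im * ‖K‖) ^ 2 = 9 / 2 * (1 + M)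
    field_simp
  have hρlam : 2 * (v.im * ‖K‖) * ρ₀ ≤ 1 := by
    have e : 2 * (v.im * ‖K‖) * ρ₀ * (v.im * ‖K‖) = 2 * (ρ₀ * (v.im * ‖K‖) ^ 2) := by ring
    have h1 : 2 * (v.im * ‖K‖) * ρ₀ * (v.im * ‖K‖) < 1 * (v.im * ‖K‖) := by
      rw [e, hρeq, one_mul]
      linarith
    exact (lt_of_mul_lt_mul_right h1 hlam.le).le
  have hwlt : w.im < v.im := im_lt_of_located hv hK hsign hwdisc hρlam
  -- the Jensen zero above `w`, and its upper representative `z`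
  obtain ⟨ρ, C, hρ0', hρ2, hgr⟩ := hG.growth
  obtain ⟨a, hFa, hwa⟩ :=
    Literature.Analysis.Complex.jensen_circle hG.diff hρ0' hρ2 hgr hG.real ⟨v, hsimple⟩ hwim.ne' hFw
  obtain ⟨z, hFz, hzim, hzre, hzabs⟩ : ∃ z : ℂ, F z = 0 ∧ 0 < z.im ∧ z.re = a.re ∧ z.im = |a.im| := by
    rcases lt_trichotomy a.im 0 with hlt | heq | hgt
    · refine ⟨conj a, ?_, by simpa using hlt, by simp, by simp [abs_of_neg hlt]⟩
      rw [Literature.Analysis.Complex.apply_conj_eq_conj hG.diff hG.real a, hFa, map_zero]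
    · exfalso
      have h0 : w - (a.re : ℂ) = 0 := by
        rw [heq, abs_zero] at hwa
        exact norm_le_zero_iff.mp hwa
      have h1 : (w - (a.re : ℂ)).im = 0 := by rw [h0, zero_im]
      simp at h1
      exact hwim.ne' h1
    · exact ⟨a, hFa, hgt, rfl, (abs_of_pos hgt).symm⟩
  have hwz : ‖w - (z.re : ℂ)‖ ≤ z.im := by
    rw [hzre, hzabs]
    exact hwa
  by_cases hnear : |z.re - v.re| < R / 2
  · -- `z = v` (the conjugate is excluded by `0 < Im z`): `w` lies in `v`'s own disc
    have hzv : z = v := by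
      rcases hiso z hFz hnear with e | e
      · exact e
      · exfalso
        rw [e, conj_im] at hzim
        linarith
    rw [hzv] at hwz
    exact lowChildAt_of_disc hFv hv hw0 hGw hwim (by rwa [abs_of_pos hv])
  · -- a FAR zero: its disc reaches `w`, hence is tall and meets `v`'s disc
    push Not at hnear
    have hHsR : 2 * Hs ≤ R := hE.2.2.2.2.2.2.2.2.2.1
    have hvR : v.im ≤ R / 2 := by
      have h1 := RhW08.Column.abs_im_le_of_level hE hnz hFv
      rw [abs_of_pos hv] at h1
      linarith
    have hzR : z.im ≤ R / 2 := by
      have h1 := RhW08.Column.abs_im_le_of_level hE hnz hFz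
      rw [abs_of_pos hzim] at h1
      linarith
    have hvz : v.im ≤ z.im := im_le_of_far_disc hv hvR hzR hnear hwz hwv
    refine ⟨w, z, hw0, hGw, hwim, hwlt, hFz, hzim, hvz, ?_, hwz⟩
    have h1 : |w.re - z.re| ≤ z.im := le_trans (by simpa using abs_re_le_norm (w - (z.re : ℂ))) hwz
    have h2 : |w.re - v.re| ≤ v.im / 6 := le_trans (by simpa using abs_re_le_norm (w - v)) hwv
    rw [abs_sub_comm] at h1
    linarith [abs_sub_le z.re w.re v.re]

end RhW08.LightIsolatedChild
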